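import Summits.BirchSwinnertonDyer.BirchSwinnertonDyer.Theorems.KolyvaginDepthDoorDepthTableKuriharaRankPin
import HarnessLib

/-!
# Route `KolyvaginDepthDoor`, crux `KolyvaginDepthSupplyKN` (stmt-BirchSwinnertonDyer-22820) —
# DEPTH TABLE v26 «THE RECORD PINS THE RANK», TWO-WAY with Kim's hypothesis (iv) IN ITS PRINTED FORM `p ∤ ∏ c_v`
# (so also on the SPLIT-Kodaira–Néron records: `p ∣ ord_q(Δ_min)` only at NON-split multiplicative `q`)

Helper file of the lead prover of line `levelone` (kdd-p1 g30; `--supports stmt-BirchSwinnertonDyer-22820 --as helper`); it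
closes nothing and BSD is NOT proved by it.

v22's converse `kuriharaClaim_pair_of_natCard_selmerGroup_le_sq` and v26's `kuriharaClaim_pair_iff_rank_eq_two_and_sha_eq_bot` take the
crux's Kodaira–Néron clause «`p ∤ ord_v(Δ_min)` at EVERY multiplicative place» and derive Sakamoto's / Kim's hypothesis `p ∤ ∏_v c_v` from
it. The printed hypothesis is the latter (Sakamoto 2022 §1 (c): `p ∤ #E(𝔽_p)·∏ Tam_ℓ(E)`; Kim 2026 Thm. 1.11 (iv)), and v25 showed it holds
on 494 further depth-two unit records whose prime divides `ord_q(Δ_min)` only at non-split `q` (`c_q ≤ 2`; the «split-KN» rows). Here: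

* `kuriharaClaim_pair_of_natCard_selmerGroup_le_sq_of_tamagawa` — v22's converse with `htam : ¬ p ∣ W.tamagawaProduct` as the hypothesis
  (Sakamoto L4.4/L4.6 (1) by name, `hSakR`): `#Sel_p(E) ≤ p²` + the three local witnesses ⟹ unit at the prescribed pair.
* `kuriharaClaim_pair_iff_rank_eq_two_and_sha_eq_bot_of_tamagawa` — TWO-WAY with the rank inside, (iv) as printed: «unit at the pair for every
  admissible datum ⟺ `rank_ℤ E(ℚ) = 2 ∧ Ш(E/ℚ)[p] = 0`», given the three local witnesses; `p ≥ 5` good ordinary, `ρ̄` onto, `a_p ≢ 1`.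
* `kuriharaClaim_pair_iff_rank_eq_two_and_sha_eq_bot_of_splitKN_int` — the row shape for a literal integral model with (iv) from the SPLIT
  multiplicative places (`not_dvd_tamagawaProduct_of_splitKodairaNeron`), i.e. the two-way upgrade of v25's one-way split-KN rows.

HONEST FRAMING. Per curve; CONDITIONAL on `hKimG`, `hnf`, `hMaz`, `hSakR` by name and on the record's claim; nothing class-wide; BSD is NOT proved
by any of this.

References: [Sakamoto2022pSelmer] §1 (a)–(c), Lemma 4.4, Remark 4.5, Lemma 4.6 (1) (arXiv:2106.03370 pp. 2–3, 14); [Kim2022StructureSelmer]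
Thm. 1.11 (iv) (PDF p. 8); [SilvermanATAEC1994] Cor. IV.9.2 (d); [SilvermanAEC2009] X.4.2.
-/

set_option linter.dupNamespace false

noncomputable section

open scoped Classical NumberField

namespace Summit.BirchSwinnertonDyer.BirchSwinnertonDyer.Theorems.KolyvaginDepthDoor

open Literature.NumberTheory.EllipticCurves Literature.NumberTheory.EllipticCurves.ModularForms
  WeierstrassCurve NumberField IsDedekindDomain
open Summit.BirchSwinnertonDyer.BirchSwinnertonDyer.Theorems

/-- **Sakamoto's converse at the prescribed pair with (iv) as printed (`p ∤ ∏ c_v`).** `W` globally minimal; `p ≥ 5` good ordinary,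
`ρ̄_{E,p}` onto, `a_p ≢ 1 (mod p)`, `p ∤ ∏_v c_v`; `#Sel_p(E/ℚ) ≤ p²`; `n = ℓ₁ℓ₂` a cyclic Kolyvagin level; `P₁, P₂ ∈ E(ℚ)` with the three
local witnesses. THEN every admissible datum carries a unit Kurihara number AT `n` — v22's `kuriharaClaim_pair_of_natCard_selmerGroup_le_sq`
with the Tamagawa hypothesis taken verbatim instead of being derived from the all-places Kodaira–Néron clause. CONDITIONAL on `hSakR`; BSD is
not proved by it. [cite: Sakamoto2022pSelmer, Lemma 4.4, Remark 4.5, Lemma 4.6 (1) (p. 14)] [cite: SilvermanAEC2009, VII.3 Prop. 3.1] -/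
theorem kuriharaClaim_pair_of_natCard_selmerGroup_le_sq_of_tamagawa
    (hSakR : Literature.NumberTheory.EllipticCurves.Sakamoto2022_kuriharaNumber_ne_zero_of_localizationInjective)
    (W : WeierstrassCurve ℚ) [W.IsElliptic] [W.IsGloballyMinimal] (p : ℕ) [hp : Fact p.Prime] (h5 : 5 ≤ p)
    (hgood : W.HasGoodReductionAtPrime p) (hord : ¬ (p : ℤ) ∣ W.frobeniusTrace p)
    (hsur : W.HasSurjectiveModNGaloisRep p) (hna : ¬ (p : ℤ) ∣ W.frobeniusTrace p - 1)
    (htam : ¬ p ∣ W.tamagawaProduct)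
    (hle : Nat.card (W.selmerGroup p) ≤ p ^ 2)
    (ℓ₁ ℓ₂ n : ℕ) [hℓ₁ : Fact ℓ₁.Prime] [hℓ₂ : Fact ℓ₂.Prime] (hne : ℓ₁ ≠ ℓ₂) (hnl : ℓ₁ * ℓ₂ = n)
    [NeZero n] (hn : IsCyclicKolyvaginLevel W p n)
    (P₁ P₂ : W.toAffine.Point)
    (h01 : (∀ Q : (W.baseChange ℚ_[ℓ₁]).toAffine.Point,
        p • Q ≠ WeierstrassCurve.Affine.Point.map (W' := W.toAffine) (S := ℚ) (Algebra.ofId ℚ ℚ_[ℓ₁]) P₂) ∨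
      (∀ Q : (W.baseChange ℚ_[ℓ₂]).toAffine.Point,
        p • Q ≠ WeierstrassCurve.Affine.Point.map (W' := W.toAffine) (S := ℚ) (Algebra.ofId ℚ ℚ_[ℓ₂]) P₂))
    (h10 : (∀ Q : (W.baseChange ℚ_[ℓ₁]).toAffine.Point,
        p • Q ≠ WeierstrassCurve.Affine.Point.map (W' := W.toAffine) (S := ℚ) (Algebra.ofId ℚ ℚ_[ℓ₁]) P₁) ∨
      (∀ Q : (W.baseChange ℚ_[ℓ₂]).toAffine.Point,
        p • Q ≠ WeierstrassCurve.Affine.Point.map (W' := W.toAffine) (S := ℚ) (Algebra.ofId ℚ ℚ_[ℓ₂]) P₁))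
    (h1t : ∀ t, 1 ≤ t → t < p →
      (∀ Q : (W.baseChange ℚ_[ℓ₁]).toAffine.Point,
        p • Q ≠ 1 • WeierstrassCurve.Affine.Point.map (W' := W.toAffine) (S := ℚ) (Algebra.ofId ℚ ℚ_[ℓ₁]) P₁ +
          t • WeierstrassCurve.Affine.Point.map (W' := W.toAffine) (S := ℚ) (Algebra.ofId ℚ ℚ_[ℓ₁]) P₂) ∨
      (∀ Q : (W.baseChange ℚ_[ℓ₂]).toAffine.Point,
        p • Q ≠ 1 • WeierstrassCurve.Affine.Point.map (W' := W.toAffine) (S := ℚ) (Algebra.ofId ℚ ℚ_[ℓ₂]) P₁ +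
          t • WeierstrassCurve.Affine.Point.map (W' := W.toAffine) (S := ℚ) (Algebra.ofId ℚ ℚ_[ℓ₂]) P₂))
    {N : ℕ} [NeZero N] (D : ModularParametrizationData W N) (hc : ¬ (p : ℤ) ∣ D.maninConstant)
    (hu : ∃ u : ℚ, ‖(u : ℚ_[p])‖ = 1 ∧ W.realPeriodRat = u * plusPeriod D.f) :
    ∃ ψ : (q : ℕ) → (ZMod q)ˣ →* Multiplicative (ZMod p),
      (∀ q ∈ n.primeFactors, Function.Surjective (ψ q)) ∧ kuriharaNumber D.f p n ψ ≠ 0 := by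
  have hnap : ¬ p ∣ W.reductionPointCount p := fun h ↦
    hna ((dvd_reductionPointCount_iff_dvd_frobeniusTrace_sub_one W p).mp h)
  have hℓ₁P : ℓ₁.Prime := hℓ₁.out
  have hℓ₂P : ℓ₂.Prime := hℓ₂.out
  have hpf : n.primeFactors = {ℓ₁, ℓ₂} := by
    rw [← hnl, Nat.primeFactors_mul hℓ₁P.ne_zero hℓ₂P.ne_zero, hℓ₁P.primeFactors, hℓ₂P.primeFactors]
    rfl
  have hcard : n.primeFactors.card = 2 := by rw [hpf, Finset.card_pair hne]
  have hall := localWitness_of_representatives p _ _ _ _ h01 h10 h1t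
  refine hSakR W p h5 ⟨hgood, hord⟩ hsur hnap htam D hc hu 2 hle n hn hcard ![P₁, P₂] ?_
  intro a ha
  have hab : ¬ (p ∣ a 0 ∧ p ∣ a 1) := by
    obtain ⟨i, hi⟩ := ha
    fin_cases i
    · exact fun h ↦ hi h.1
    · exact fun h ↦ hi h.2
  rcases hall (a 0) (a 1) hab with h | h
  · refine ⟨ℓ₁, hℓ₁, by rw [hpf]; exact Finset.mem_insert_self _ _, fun Q hQ ↦ h Q (hQ.trans ?_)⟩
    rw [Fin.sum_univ_two]
    rfl
  · refine ⟨ℓ₂, hℓ₂, by rw [hpf]; exact Finset.mem_insert_of_mem (Finset.mem_singleton_self _),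
      fun Q hQ ↦ h Q (hQ.trans ?_)⟩
    rw [Fin.sum_univ_two]
    rfl

/-- **TWO-WAY with the rank inside and (iv) AS PRINTED.** `W` globally minimal; `p ≥ 5` good ordinary, `ρ̄_{E,p}` onto, `a_p ≢ 1 (mod p)`,
`p ∤ ∏_v c_v`; `n = ℓ₁ℓ₂` a cyclic Kolyvagin level; `P₁, P₂ ∈ E(ℚ)` with the three local witnesses at `(ℓ₁, ℓ₂)`. THEN «unit mod-`p`
Kurihara number at `n` for every admissible datum» ⟺ «`rank_ℤ E(ℚ) = 2 ∧ Ш(E/ℚ)[p] = 0`». `⟹`: v26 §3 ((iii) from `a_p ≢ 1`); `⟸`: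
`#Sel_p(E) = p²` and the lemma above. CONDITIONAL on `hKimG`, `hnf`, `hMaz`, `hSakR`; per curve; BSD is not proved by it.
[cite: Kim2022StructureSelmer, Thm. 1.11 (PDF p. 8)] [cite: Sakamoto2022pSelmer, Lemma 4.4, Lemma 4.6 (1) (p. 14)] [cite: SilvermanAEC2009, Thm. X.4.2] -/
theorem kuriharaClaim_pair_iff_rank_eq_two_and_sha_eq_bot_of_tamagawa
    (hKimG : Literature.NumberTheory.EllipticCurves.Kim2022_card_selmerGroup_le_pow_of_kuriharaNumber_ne_zero_of_hasGoodReduction)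
    (hnf : exists_isNewformOf) (hMaz : mazur_not_dvd_maninConstant_of_odd)
    (hSakR : Literature.NumberTheory.EllipticCurves.Sakamoto2022_kuriharaNumber_ne_zero_of_localizationInjective)
    (W : WeierstrassCurve ℚ) [W.IsElliptic] [W.IsGloballyMinimal] (p : ℕ) [hp : Fact p.Prime] (h5 : 5 ≤ p)
    (hgood : W.HasGoodReductionAtPrime p) (hord : ¬ (p : ℤ) ∣ W.frobeniusTrace p)
    (hsur : W.HasSurjectiveModNGaloisRep p) (hna : ¬ (p : ℤ) ∣ W.frobeniusTrace p - 1)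
    (htam : ¬ p ∣ W.tamagawaProduct)
    [iNZ : NeZero (W.conductorNorm ℤ)]
    (ℓ₁ ℓ₂ n : ℕ) [hℓ₁ : Fact ℓ₁.Prime] [hℓ₂ : Fact ℓ₂.Prime] (hne : ℓ₁ ≠ ℓ₂) (hnl : ℓ₁ * ℓ₂ = n)
    [NeZero n] (hn : IsCyclicKolyvaginLevel W p n)
    (P₁ P₂ : W.toAffine.Point)
    (h01 : (∀ Q : (W.baseChange ℚ_[ℓ₁]).toAffine.Point,
        p • Q ≠ WeierstrassCurve.Affine.Point.map (W' := W.toAffine) (S := ℚ) (Algebra.ofId ℚ ℚ_[ℓ₁]) P₂) ∨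
      (∀ Q : (W.baseChange ℚ_[ℓ₂]).toAffine.Point,
        p • Q ≠ WeierstrassCurve.Affine.Point.map (W' := W.toAffine) (S := ℚ) (Algebra.ofId ℚ ℚ_[ℓ₂]) P₂))
    (h10 : (∀ Q : (W.baseChange ℚ_[ℓ₁]).toAffine.Point,
        p • Q ≠ WeierstrassCurve.Affine.Point.map (W' := W.toAffine) (S := ℚ) (Algebra.ofId ℚ ℚ_[ℓ₁]) P₁) ∨
      (∀ Q : (W.baseChange ℚ_[ℓ₂]).toAffine.Point,
        p • Q ≠ WeierstrassCurve.Affine.Point.map (W' := W.toAffine) (S := ℚ) (Algebra.ofId ℚ ℚ_[ℓ₂]) P₁))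
    (h1t : ∀ t, 1 ≤ t → t < p →
      (∀ Q : (W.baseChange ℚ_[ℓ₁]).toAffine.Point,
        p • Q ≠ 1 • WeierstrassCurve.Affine.Point.map (W' := W.toAffine) (S := ℚ) (Algebra.ofId ℚ ℚ_[ℓ₁]) P₁ +
          t • WeierstrassCurve.Affine.Point.map (W' := W.toAffine) (S := ℚ) (Algebra.ofId ℚ ℚ_[ℓ₁]) P₂) ∨
      (∀ Q : (W.baseChange ℚ_[ℓ₂]).toAffine.Point,
        p • Q ≠ 1 • WeierstrassCurve.Affine.Point.map (W' := W.toAffine) (S := ℚ) (Algebra.ofId ℚ ℚ_[ℓ₂]) P₁ +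
          t • WeierstrassCurve.Affine.Point.map (W' := W.toAffine) (S := ℚ) (Algebra.ofId ℚ ℚ_[ℓ₂]) P₂)) :
    (∀ (D : ModularParametrizationData W (W.conductorNorm ℤ)), ¬ (p : ℤ) ∣ D.maninConstant →
        (∃ u : ℚ, ‖(u : ℚ_[p])‖ = 1 ∧ W.realPeriodRat = u * plusPeriod D.f) →
        ∃ ψ : (q : ℕ) → (ZMod q)ˣ →* Multiplicative (ZMod p),
          (∀ q ∈ n.primeFactors, Function.Surjective (ψ q)) ∧ kuriharaNumber D.f p n ψ ≠ 0) ↔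
      (W.mordellWeilRank = 2 ∧ (W.sha ⊓ AddSubgroup.torsionBy W.galH1 (p : ℤ) : AddSubgroup W.galH1) = ⊥) := by
  constructor
  · intro hδ
    exact rank_eq_two_and_sha_eq_bot_of_kuriharaClaim_of_localWitness hKimG hnf hMaz W p h5 hgood hsur
      (localTorsionTrivial_of_nonAnomalous W p (by omega) hgood hna) htam ℓ₁ ℓ₂ n hne hnl hn P₁ P₂ h01 h10 h1t hδ
  · rintro ⟨hrank, hsha⟩ D hc hu
    have hirr : W.HasIrreducibleModPGaloisRep p := hasIrreducibleModPGaloisRep_of_hasSurjectiveModNGaloisRep W p hsur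
    have hle : Nat.card (W.selmerGroup p) ≤ p ^ 2 := by
      rw [natCard_selmerGroup_eq_pow_rank_of_sha_inf_torsionBy_eq_bot W p hirr hsha, hrank]
    exact kuriharaClaim_pair_of_natCard_selmerGroup_le_sq_of_tamagawa hSakR W p h5 hgood hord hsur hna htam hle ℓ₁ ℓ₂ n hne
      hnl hn P₁ P₂ h01 h10 h1t D hc hu

/-- **The SPLIT-KN two-way row shape** for the rational curve of an integral globally minimal `E₀` at a good ordinary non-anomalous `p ≥ 5`
with `ρ̄` onto and `p ∤ ord_v(Δ_min)` at the SPLIT multiplicative places (the non-split ones exempt: `c_v ≤ 2`): «unit at the recorded pair ⟺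
`rank = 2 ∧ Ш[p] = 0`» — the two-way upgrade of v25's one-way `…SplitKN<key>` rows, rank inside, no 2-descent. CONDITIONAL on `hKimG`,
`hnf`, `hMaz`, `hSakR` and the claim; per curve; BSD is not proved by it. [cite: Sakamoto2022pSelmer, Lemma 4.4, Lemma 4.6 (1)]
[cite: SilvermanATAEC1994, Cor. IV.9.2 (d)] -/
theorem kuriharaClaim_pair_iff_rank_eq_two_and_sha_eq_bot_of_splitKN_int
    (hKimG : Literature.NumberTheory.EllipticCurves.Kim2022_card_selmerGroup_le_pow_of_kuriharaNumber_ne_zero_of_hasGoodReduction)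
    (hnf : exists_isNewformOf) (hMaz : mazur_not_dvd_maninConstant_of_odd)
    (hSakR : Literature.NumberTheory.EllipticCurves.Sakamoto2022_kuriharaNumber_ne_zero_of_localizationInjective)
    (W₀ : WeierstrassCurve ℤ) [(W₀.map (Int.castRingHom ℚ)).IsElliptic]
    [(W₀.map (Int.castRingHom ℚ)).IsGloballyMinimal] (p : ℕ) [hp : Fact p.Prime] (h5 : 5 ≤ p)
    (hgood : (W₀.map (Int.castRingHom ℚ)).HasGoodReductionAtPrime p)
    (hord : ¬ (p : ℤ) ∣ (W₀.map (Int.castRingHom ℚ)).frobeniusTrace p)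
    (hsur : (W₀.map (Int.castRingHom ℚ)).HasSurjectiveModNGaloisRep p)
    (hna : ¬ (p : ℤ) ∣ (W₀.map (Int.castRingHom ℚ)).frobeniusTrace p - 1)
    (hsKN : ∀ v : HeightOneSpectrum (𝓞 ℚ), (W₀.map (Int.castRingHom ℚ)).HasSplitMultiplicativeReductionAt v →
      ¬ p ∣ (W₀.map (Int.castRingHom ℚ)).ordMinimalDiscriminant v)
    [iNZ : NeZero ((W₀.map (Int.castRingHom ℚ)).conductorNorm ℤ)]
    (ℓ₁ ℓ₂ n : ℕ) [Fact ℓ₁.Prime] [Fact ℓ₂.Prime] (hne : ℓ₁ ≠ ℓ₂) (hnl : ℓ₁ * ℓ₂ = n) [NeZero n]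
    (hn : IsCyclicKolyvaginLevel (W₀.map (Int.castRingHom ℚ)) p n)
    (P₁ P₂ : (W₀.map (Int.castRingHom ℚ)).toAffine.Point)
    (h01 : (∀ Q : ((W₀.map (Int.castRingHom ℚ)).baseChange ℚ_[ℓ₁]).toAffine.Point,
        p • Q ≠ WeierstrassCurve.Affine.Point.map (W' := (W₀.map (Int.castRingHom ℚ)).toAffine) (S := ℚ)
          (Algebra.ofId ℚ ℚ_[ℓ₁]) P₂) ∨
      (∀ Q : ((W₀.map (Int.castRingHom ℚ)).baseChange ℚ_[ℓ₂]).toAffine.Point,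
        p • Q ≠ WeierstrassCurve.Affine.Point.map (W' := (W₀.map (Int.castRingHom ℚ)).toAffine) (S := ℚ)
          (Algebra.ofId ℚ ℚ_[ℓ₂]) P₂))
    (h10 : (∀ Q : ((W₀.map (Int.castRingHom ℚ)).baseChange ℚ_[ℓ₁]).toAffine.Point,
        p • Q ≠ WeierstrassCurve.Affine.Point.map (W' := (W₀.map (Int.castRingHom ℚ)).toAffine) (S := ℚ)
          (Algebra.ofId ℚ ℚ_[ℓ₁]) P₁) ∨
      (∀ Q : ((W₀.map (Int.castRingHom ℚ)).baseChange ℚ_[ℓ₂]).toAffine.Point,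
        p • Q ≠ WeierstrassCurve.Affine.Point.map (W' := (W₀.map (Int.castRingHom ℚ)).toAffine) (S := ℚ)
          (Algebra.ofId ℚ ℚ_[ℓ₂]) P₁))
    (h1t : ∀ t, 1 ≤ t → t < p →
      (∀ Q : ((W₀.map (Int.castRingHom ℚ)).baseChange ℚ_[ℓ₁]).toAffine.Point,
        p • Q ≠ 1 • WeierstrassCurve.Affine.Point.map (W' := (W₀.map (Int.castRingHom ℚ)).toAffine) (S := ℚ)
            (Algebra.ofId ℚ ℚ_[ℓ₁]) P₁ +
          t • WeierstrassCurve.Affine.Point.map (W' := (W₀.map (Int.castRingHom ℚ)).toAffine) (S := ℚ)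
            (Algebra.ofId ℚ ℚ_[ℓ₁]) P₂) ∨
      (∀ Q : ((W₀.map (Int.castRingHom ℚ)).baseChange ℚ_[ℓ₂]).toAffine.Point,
        p • Q ≠ 1 • WeierstrassCurve.Affine.Point.map (W' := (W₀.map (Int.castRingHom ℚ)).toAffine) (S := ℚ)
            (Algebra.ofId ℚ ℚ_[ℓ₂]) P₁ +
          t • WeierstrassCurve.Affine.Point.map (W' := (W₀.map (Int.castRingHom ℚ)).toAffine) (S := ℚ)
            (Algebra.ofId ℚ ℚ_[ℓ₂]) P₂)) :
    (∀ (D : ModularParametrizationData (W₀.map (Int.castRingHom ℚ))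
        ((W₀.map (Int.castRingHom ℚ)).conductorNorm ℤ)), ¬ (p : ℤ) ∣ D.maninConstant →
        (∃ u : ℚ, ‖(u : ℚ_[p])‖ = 1 ∧ (W₀.map (Int.castRingHom ℚ)).realPeriodRat = u * plusPeriod D.f) →
        ∃ ψ : (q : ℕ) → (ZMod q)ˣ →* Multiplicative (ZMod p),
          (∀ q ∈ n.primeFactors, Function.Surjective (ψ q)) ∧ kuriharaNumber D.f p n ψ ≠ 0) ↔
      ((W₀.map (Int.castRingHom ℚ)).mordellWeilRank = 2 ∧
        ((W₀.map (Int.castRingHom ℚ)).sha ⊓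
          AddSubgroup.torsionBy (W₀.map (Int.castRingHom ℚ)).galH1 (p : ℤ) : AddSubgroup _) = ⊥) :=
  kuriharaClaim_pair_iff_rank_eq_two_and_sha_eq_bot_of_tamagawa hKimG hnf hMaz hSakR _ p h5 hgood hord hsur hna
    (not_dvd_tamagawaProduct_of_splitKodairaNeron _ p h5 hsKN) ℓ₁ ℓ₂ n hne hnl hn P₁ P₂ h01 h10 h1t

end Summit.BirchSwinnertonDyer.BirchSwinnertonDyer.Theorems.KolyvaginDepthDoor

end
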